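import Summits.ValiantsHypothesis.ValiantsHypothesis.Theorems.LacunarySymmetroidMatrixDescartesCensusTropicalKLawSlopes
import Summits.ValiantsHypothesis.ValiantsHypothesis.Theorems.LacunarySymmetroidMatrixDescartesCensusTropicalKLawBridges
import Summits.ValiantsHypothesis.ValiantsHypothesis.Theorems.LacunarySymmetroidMatrixDescartesCensusFrame

/-!
# Route «KPlusLogSqLaw», crux `Lifting` — the DESCARTES ZONE of format-level lifting (linear cones `m ≤ c·K`)

HONEST FRAMING.  Helper file for the crux `Summit.ValiantsHypothesis.ValiantsHypothesis.Theses.KPlusLogSqLaw.Lifting`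
(ledger item `stmt-ValiantsHypothesis-19772`, route `KPlusLogSqLaw`, object-search cell `pub-symmetroid`, seat
val-sym-lift-p2, 2026-08-26).  It proves PARTIAL RANGES of the registered regime stubs `stub_liftFat` / `stub_liftThin`
(`TropRow m K n → RealRootLawAt m K (2^(C·K)·(n+1))`) and nothing else: the ranges are exactly the formats where the
real Descartes ceiling `Census.realRootLawAt_descartes` (`ζ(m,K) ≤ 2·C(m+K−1,m) − 1`) is ITSELF below `2^(C·K)`, so the
tropical hypothesis is not used («Descartes-vacuous» lifting).  Nothing here asserts `Lifting`, `TropicalB`,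
`KPlusLogSqLaw`, `MatrixDescartes` or anything about `VP ≠ VNP`; the crux stays open.

WHAT IS PROVED (all sorry-free), writing `T-row` for `TropicalCensus.TropRootLawAt` (δ-equal to the skeleton's `TropRow`)
and `R-row` for `LacunarySymmetroidMatrixDescartes.RealRootLawAt`:
* `realRootLawAt_linearZone : m + K ≤ C·K → R-row m K (2^(C·K))` — crude counting `C(m+K−1,m) ≤ 2^(m+K−1)`; this moves
  the kernel frontier of the fat stub from `m ≤ K` (`Lifting_rung_fatEnd`, skeleton, constant `3`) to `m ≤ (C−1)·K`
  (constant `C`), and `lift_linearZone` is the stub-shaped form (tropical hypothesis carried, unused).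
* `choose_le_entropyPow : C((c+1)·K, K) ≤ (3(c+1))^K` (the entropy bound `C(n,k) ≤ (e·n/k)^k` with `e < 3`, via
  `Nat.choose_le_pow_div` and `Real.pow_div_factorial_le_exp`), `choose_format_le_entropyPow : m ≤ c·K → 0 < K →
  C(m+K−1,m) ≤ (3(c+1))^K`, and the sharper zone `realRootLawAt_entropyZone : m ≤ c·K → 3(c+1) ≤ 2^a →
  R-row m K (2^((a+1)·K))` — i.e. constant `C` covers the cone `m ≤ (2^(C−1)/3 − 1)·K`, exponentially wider than the
  linear zone; `lift_entropyZone` is the stub-shaped form.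
* `lifting_on_linearCones : ∀ c, ∃ C, ∀ m K n, m ≤ c·K → T-row m K n → R-row m K (2^(C·K)·(n+1))` — LIFT HOLDS ON EVERY
  LINEAR CONE, with a cone-dependent constant (`C = c + 1`; `C = ⌈log₂ 3(c+1)⌉ + 1` by the entropy zone).

WHAT IS NOT PROVED, located.  The stubs quantify `∃ C` OUTERMOST; in the fat regime `log₂² m ≤ K` the formats left open
by this file are `c·K < m ≤ 2^(√K)` for the chosen `c`, where Descartes gives `K·log₂(e·m/K)` bits against the budget
`C·K + log₂(n+1)`: there format-level lifting needs either a real zero bound below Descartes for symmetric lacunary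
pencils or tropical designs within `2^(−O(K))` of the slope count — both open (cell file ONBOARD-val-sym.md §3.4).
-/

set_option linter.dupNamespace false
set_option autoImplicit false

namespace Summit.ValiantsHypothesis.ValiantsHypothesis.Theorems.KPlusLogSqLaw

open Summit.ValiantsHypothesis.ValiantsHypothesis.Theorems.LacunarySymmetroidMatrixDescartes (RealRootLawAt)
open Summit.ValiantsHypothesis.ValiantsHypothesis.Theorems.LacunarySymmetroidMatrixDescartes.TropicalCensus (TropRootLawAt)

/-! ## 1. The linear zone `m + K ≤ C·K` (crude counting) -/

/-- Twice the Descartes monomial count of the format `(m, K)`, `K ≥ 1`, is at most `2^(m+K)`. [folklore] -/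
theorem two_mul_choose_format_le_two_pow (m K : ℕ) (hK : 0 < K) :
    2 * Nat.choose (m + K - 1) m ≤ 2 ^ (m + K) := by
  have h1 : Nat.choose (m + K - 1) m ≤ 2 ^ (m + K - 1) := Nat.choose_le_two_pow _ _
  have h2 : 2 * 2 ^ (m + K - 1) = 2 ^ (m + K) := by
    rw [← pow_succ']; congr 1; omega
  omega

/-- **Linear Descartes zone.**  If `m + K ≤ C·K` (i.e. `m ≤ (C−1)·K`) then every real symmetric lacunary pencil of
format `(m, K)` has at most `2^(C·K)` distinct real zeros of its determinant — Descartes alone. [folklore] -/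
theorem realRootLawAt_linearZone {C m K : ℕ} (hmK : m + K ≤ C * K) : RealRootLawAt m K (2 ^ (C * K)) := by
  rcases Nat.eq_zero_or_pos K with hK | hK
  · subst hK
    exact LacunarySymmetroidMatrixDescartes.TropicalCensus.realRootLawAt_zero m _
  refine LacunarySymmetroidMatrixDescartes.Census.realRootLawAt_mono ?_
    (LacunarySymmetroidMatrixDescartes.Census.realRootLawAt_descartes m K hK)
  have h1 := two_mul_choose_format_le_two_pow m K hK
  have h2 : 2 ^ (m + K) ≤ 2 ^ (C * K) := Nat.pow_le_pow_right (by norm_num) hmK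
  omega

/-- **LIFT on the linear zone** (stub-shaped; the tropical row is carried but not used): for `m + K ≤ C·K`,
`TropRootLawAt m K n → RealRootLawAt m K (2^(C·K)·(n+1))`.  At `C = 2` this is the skeleton's fat-end rung
`m ≤ K`; the registered stubs `stub_liftFat` / `stub_liftThin` restricted to `m ≤ (C−1)·K` follow. [folklore] -/
theorem lift_linearZone (C m K n : ℕ) (hmK : m + K ≤ C * K) (_h : TropRootLawAt m K n) :
    RealRootLawAt m K (2 ^ (C * K) * (n + 1)) :=
  LacunarySymmetroidMatrixDescartes.Census.realRootLawAt_mono (Nat.le_mul_of_pos_right _ (Nat.succ_pos n))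
    (realRootLawAt_linearZone hmK)

/-! ## 2. The entropy zone `m ≤ c·K` with constant `⌈log₂ 3(c+1)⌉ + 1` -/

/-- Entropy bound for the central-type binomial coefficient: `C((c+1)·K, K) ≤ (3(c+1))^K`
(from `C(n,k) ≤ n^k/k!`, `k^k/k! ≤ e^k` and `e < 3`). [folklore] -/
theorem choose_le_entropyPow (c K : ℕ) : Nat.choose ((c + 1) * K) K ≤ (3 * (c + 1)) ^ K := by
  have hR : (Nat.choose ((c + 1) * K) K : ℝ) ≤ ((3 * (c + 1)) ^ K : ℕ) := by
    have h1 : (Nat.choose ((c + 1) * K) K : ℝ) ≤ ((((c + 1) * K : ℕ) : ℝ) ^ K) / (K.factorial : ℝ) :=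
      Nat.choose_le_pow_div K ((c + 1) * K)
    have h2 : ((K : ℝ) ^ K) / (K.factorial : ℝ) ≤ Real.exp K := by
      have := Real.pow_div_factorial_le_exp (x := (K : ℝ)) (Nat.cast_nonneg K) K
      simpa using this
    have h3 : Real.exp (K : ℝ) ≤ (3 : ℝ) ^ K := by
      rw [← mul_one (K : ℝ), Real.exp_nat_mul]
      exact pow_le_pow_left₀ (Real.exp_pos 1).le Real.exp_one_lt_three.le K
    have h4 : ((((c + 1) * K : ℕ) : ℝ) ^ K) / (K.factorial : ℝ)
        = ((c + 1 : ℝ)) ^ K * (((K : ℝ) ^ K) / (K.factorial : ℝ)) := by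
      push_cast
      rw [mul_pow, mul_div_assoc]
    calc (Nat.choose ((c + 1) * K) K : ℝ) ≤ ((((c + 1) * K : ℕ) : ℝ) ^ K) / (K.factorial : ℝ) := h1
      _ = ((c + 1 : ℝ)) ^ K * (((K : ℝ) ^ K) / (K.factorial : ℝ)) := h4
      _ ≤ ((c + 1 : ℝ)) ^ K * (3 : ℝ) ^ K :=
          mul_le_mul_of_nonneg_left (h2.trans h3) (pow_nonneg (by positivity) K)
      _ = ((3 * (c + 1)) ^ K : ℕ) := by push_cast; rw [← mul_pow]; ring
  exact_mod_cast hR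

/-- The Descartes monomial count of a format in the cone `m ≤ c·K` (`K ≥ 1`) is at most `(3(c+1))^K`:
`C(m+K−1, m) = C(m+K−1, K−1) ≤ C((c+1)K − 1, K − 1) ≤ C((c+1)K, K)`. [folklore] -/
theorem choose_format_le_entropyPow {c m K : ℕ} (hm : m ≤ c * K) (hK : 0 < K) :
    Nat.choose (m + K - 1) m ≤ (3 * (c + 1)) ^ K := by
  have hsymm : Nat.choose (m + K - 1) m = Nat.choose (m + K - 1) (K - 1) :=
    Nat.choose_symm_of_eq_add (by omega)
  have hcK : (c + 1) * K = c * K + K := by ring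
  have h1 : Nat.choose (m + K - 1) (K - 1) ≤ Nat.choose ((c + 1) * K - 1) (K - 1) :=
    Nat.choose_le_choose (K - 1) (by omega)
  have h2 : Nat.choose ((c + 1) * K - 1) (K - 1) ≤ Nat.choose ((c + 1) * K) K := by
    have hn : (c + 1) * K = ((c + 1) * K - 1) + 1 := by omega
    have hk : K = (K - 1) + 1 := by omega
    rw [hn, hk, Nat.choose_succ_succ, ← hk]
    exact Nat.le_add_right _ _
  rw [hsymm]
  exact h1.trans (h2.trans (choose_le_entropyPow c K))

/-- **Entropy Descartes zone.**  If `m ≤ c·K` and `3(c+1) ≤ 2^a` then every real symmetric lacunary pencil of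
format `(m, K)` has at most `2^((a+1)·K)` distinct real zeros of its determinant — Descartes alone; e.g.
`m ≤ 9K ⇒ ζ ≤ 2^(6K)`, `m ≤ 20K ⇒ ζ ≤ 2^(7K)`, `m ≤ 340K ⇒ ζ ≤ 2^(11K)`. [folklore] -/
theorem realRootLawAt_entropyZone {c a m K : ℕ} (hm : m ≤ c * K) (ha : 3 * (c + 1) ≤ 2 ^ a) :
    RealRootLawAt m K (2 ^ ((a + 1) * K)) := by
  rcases Nat.eq_zero_or_pos K with hK | hK
  · subst hK
    exact LacunarySymmetroidMatrixDescartes.TropicalCensus.realRootLawAt_zero m _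
  refine LacunarySymmetroidMatrixDescartes.Census.realRootLawAt_mono ?_
    (LacunarySymmetroidMatrixDescartes.Census.realRootLawAt_descartes m K hK)
  have h1 := choose_format_le_entropyPow hm hK
  have h2 : (3 * (c + 1)) ^ K ≤ (2 ^ a) ^ K := Nat.pow_le_pow_left ha K
  have h3 : 2 * (2 ^ a) ^ K = 2 ^ (a * K + 1) := by rw [← pow_mul, pow_succ]; ring
  have h4 : 2 ^ (a * K + 1) ≤ 2 ^ ((a + 1) * K) := Nat.pow_le_pow_right (by norm_num) (by nlinarith)
  omega

/-- **LIFT on the entropy zone** (stub-shaped; tropical row carried, unused): `m ≤ c·K → 3(c+1) ≤ 2^a →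
TropRootLawAt m K n → RealRootLawAt m K (2^((a+1)·K)·(n+1))`. [folklore] -/
theorem lift_entropyZone (c a m K n : ℕ) (hm : m ≤ c * K) (ha : 3 * (c + 1) ≤ 2 ^ a) (_h : TropRootLawAt m K n) :
    RealRootLawAt m K (2 ^ ((a + 1) * K) * (n + 1)) :=
  LacunarySymmetroidMatrixDescartes.Census.realRootLawAt_mono (Nat.le_mul_of_pos_right _ (Nat.succ_pos n))
    (realRootLawAt_entropyZone hm ha)

/-! ## 3. LIFT holds on every linear cone (cone-dependent constant) -/

/-- **Format-level lifting on linear cones.**  For every `c` there is `C` (namely `c + 1`) such that on all formats with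
`m ≤ c·K` the tropical row lifts to the real row at cost `2^(C·K)`: the restriction of the crux `Lifting` (and of both
regime stubs `stub_liftThin`, `stub_liftFat`) to the cone `m ≤ c·K`.  The crux itself asks for ONE `C` serving all
cones at once, which this file does not provide. [folklore] -/
theorem lifting_on_linearCones (c : ℕ) :
    ∃ C : ℕ, ∀ m K n : ℕ, m ≤ c * K → TropRootLawAt m K n → RealRootLawAt m K (2 ^ (C * K) * (n + 1)) :=
  ⟨c + 1, fun m K n hm h => lift_linearZone (c + 1) m K n (by nlinarith) h⟩

/-- The same with the entropy constant: on the cone `m ≤ c·K`, any `C = a + 1` with `3(c+1) ≤ 2^a` serves. [folklore] -/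
theorem lifting_on_linearCones_entropy (c a : ℕ) (ha : 3 * (c + 1) ≤ 2 ^ a) :
    ∀ m K n : ℕ, m ≤ c * K → TropRootLawAt m K n → RealRootLawAt m K (2 ^ ((a + 1) * K) * (n + 1)) :=
  fun m K n hm h => lift_entropyZone c a m K n hm ha h

end Summit.ValiantsHypothesis.ValiantsHypothesis.Theorems.KPlusLogSqLaw
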